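import Literature.AnabelianGeometry.EtaleTheta.ThetaEnvOfSetting
import Literature.AnabelianGeometry.EtaleTheta.ThetaSystems
import Mathlib.RingTheory.RootsOfUnity.PrimitiveRoots
import HarnessLib

/-!
# [EtTh] §2 over §1: the projective system of theta-environment data of `X̲̲` over all levels
# `M ∈ E` (merge adapter, part 4: `ThetaEnvTower E`)

Mochizuki, *The étale theta function …*, Publ. RIMS **45** (2009), §2, PRIMS PDF pp. 46–48, 64
(printed 272–274, 290) [cite: MochizukiEtTh2009, Cor 2.19 (ii) p.64]. Layer L2 of the abc-iut cell,
wave-2 unit W2-L2-04, seat abc-iut-L2-t8. Continuation of `ThetaEnvOfSetting.lean`.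

Seat abc-iut-L2-t2's `ThetaEnvTower E` (`ThetaSystems.lean`) is the interface `ThetaEnvData` at all
levels `M` of a cofinal totally ordered `E ⊆ ℕ≥1` with the reductions `μ_{M'} ↠ μ_M` ("by letting the
integer `N` vary in `E`, we obtain a natural projective system", Cor. 2.19 (ii); "`M_{N'}` … the mod `N'`
mono-theta environment induced by `M`", Def. 2.13 (ii)) — the carrier of Cor. 2.16, 2.18 (iv), 2.19 (ii),
(iii). This file INSTANTIATES it from the §1 theta setting: the reductions are the REAL power maps
`μ_{M'} → μ_M`, `ζ ↦ ζ^{M'/M}` on the roots of unity of `ℚ̄_p` (`MuN.red`; onto, PROVED from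
`HasEnoughRootsOfUnity`), the levels are the data `DoubleUnderline.thetaEnvData` of part 2, and the only
new input is a COMPATIBLE family of identifications `μ_M ≅ (l·Δ_Θ) ⊗ ℤ/Mℤ` (`CyclotomeTower`: one
`CyclotomeMod` per level, compatible with the power maps — the level-wise form of "`Δ_Θ (≅ Ẑ(1))`", p. 12;
TODO-merge(abc-iut-L3-t2)). All tower axioms are PROVED; in particular "the mod-`M` cocycles are the
reductions of the mod-`M'` cocycles — all of them" holds because every theta cocycle of part 2 is the
reduction of an `l·Δ_Θ`-valued cocycle. HONEST FRAMING as in parts 0–3.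
-/

noncomputable section

namespace Literature.AnabelianGeometry.EtaleTheta

open Literature.AnabelianGeometry.SemiGraphs

variable (p : ℕ) [Fact p.Prime]

/-! ### The power maps `μ_{M'} ↠ μ_M` on the roots of unity of `ℚ̄_p` -/

/-- **The reduction `μ_{M'} ↠ μ_M`** for `M ∣ M'`: `ζ ↦ ζ^{M'/M}` ("`M_{N'}` … induced by `M`", Def. 2.13
(ii); the transition maps of `ℤ/N'ℤ(1) ↠ ℤ/Nℤ(1)`). [cite: MochizukiEtTh2009, Def 2.13 (ii) p.48] -/
def MuN.red (M M' : ℕ+) (h : (M : ℕ) ∣ M') : MuN p M' →* MuN p M where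
  toFun ζ := ⟨(ζ : (PadicAlgCl p)ˣ) ^ ((M' : ℕ) / M), by
    rw [mem_rootsOfUnity, ← pow_mul, Nat.div_mul_cancel h]
    exact ζ.2⟩
  map_one' := by ext; simp
  map_mul' a b := by ext; simp [mul_pow]

/-- `MuN.red` in coordinates. [cite: MochizukiEtTh2009, Def 2.13 (ii) p.48] -/
@[simp] theorem MuN.coe_red (M M' : ℕ+) (h : (M : ℕ) ∣ M') (ζ : MuN p M') :
    ((MuN.red p M M' h ζ : MuN p M) : (PadicAlgCl p)ˣ) = (ζ : (PadicAlgCl p)ˣ) ^ ((M' : ℕ) / M) := rfl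

/-- `μ_M ↠ μ_M` is the identity. [cite: MochizukiEtTh2009, Def 2.13 (ii) p.48] -/
theorem MuN.red_self (M : ℕ+) (h : (M : ℕ) ∣ M) (a : MuN p M) : MuN.red p M M h a = a := by
  ext; simp [Nat.div_self M.pos]

/-- Transitivity of the reductions: `μ_{M''} → μ_M` factors through `μ_{M'}`.
[cite: MochizukiEtTh2009, Def 2.13 (ii) p.48] -/
theorem MuN.red_comp (M M' M'' : ℕ+) (h : (M : ℕ) ∣ M') (h' : (M' : ℕ) ∣ M'') (a : MuN p M'') :
    MuN.red p M M'' (h.trans h') a = MuN.red p M M' h (MuN.red p M' M'' h' a) := by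
  have hexp : (M'' : ℕ) / M = (M'' : ℕ) / M' * ((M' : ℕ) / M) := by
    obtain ⟨a, ha⟩ := h
    obtain ⟨b, hb⟩ := h'
    have hMa : 0 < (M : ℕ) * a := by rw [← ha]; exact M'.pos
    rw [hb, ha, Nat.mul_div_cancel_left b hMa, Nat.mul_div_cancel_left a M.pos, mul_assoc,
      Nat.mul_div_cancel_left (a * b) M.pos, mul_comm]
  ext
  simp only [MuN.coe_red, ← pow_mul]
  rw [hexp]

/-- The reductions commute with the Galois action. [cite: MochizukiEtTh2009, Def 2.13 (ii) p.48] -/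
theorem MuN.red_gal (M M' : ℕ+) (h : (M : ℕ) ∣ M') (σ : GQp p) (a : MuN p M') :
    MuN.red p M M' h (galMuN p M' σ a) = galMuN p M σ (MuN.red p M M' h a) := by
  apply Subtype.ext
  apply Units.ext
  simp only [MuN.coe_red, galMuN_apply_coe, Units.val_pow_eq_pow_val, map_pow]

/-- **`μ_{M'} ↠ μ_M` is onto** (`ℚ̄_p` has enough roots of unity: a primitive `M'`-th root maps to a
primitive `M`-th root, which generates `μ_M`). [cite: MochizukiEtTh2009, Def 2.13 (ii) p.48] -/
theorem MuN.red_surjective (M M' : ℕ+) (h : (M : ℕ) ∣ M') :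
    Function.Surjective (MuN.red p M M' h) := by
  obtain ⟨ζ, hζ⟩ := HasEnoughRootsOfUnity.exists_primitiveRoot (PadicAlgCl p) M'
  have hζu := hζ.isUnit_unit M'.ne_zero
  set ζu := (hζ.isUnit M'.ne_zero).unit with hζudef
  have hmem : ζu ∈ rootsOfUnity M' (PadicAlgCl p) := by
    rw [mem_rootsOfUnity]; exact hζu.pow_eq_one
  have hd : (M' : ℕ) = (M' : ℕ) / M * M := (Nat.div_mul_cancel h).symm
  have hξ : IsPrimitiveRoot (ζu ^ ((M' : ℕ) / M)) M := hζu.pow M'.pos hd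
  intro x
  have hx : (x : (PadicAlgCl p)ˣ) ∈ Subgroup.zpowers (ζu ^ ((M' : ℕ) / M)) := by
    rw [hξ.zpowers_eq]; exact x.2
  obtain ⟨i, hi⟩ := Subgroup.mem_zpowers_iff.1 hx
  refine ⟨⟨ζu ^ i, Subgroup.zpow_mem _ hmem i⟩, Subtype.ext ?_⟩
  rw [MuN.coe_red, ← hi, ← zpow_natCast, ← zpow_natCast, ← zpow_mul, ← zpow_mul, mul_comm]

namespace ThetaSetting

variable {p} (D : ThetaSetting p)

/-! ### Compatible identifications at all levels -/

/-- **A compatible system of identifications `μ_M ≅ (l·Δ_Θ) ⊗ ℤ/Mℤ`, `M ∈ E`** ("the natural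
isomorphism", p. 46, at every level of a cofinal totally ordered `E ∋ 1`, compatible with the
reductions `μ_{M'} ↠ μ_M`) — the level-wise content of "`Δ_Θ (≅ Ẑ(1))`" (p. 12), which `Setting.lean`
defers; TODO-merge(abc-iut-L3-t2). DATA, not an assertion. [cite: MochizukiEtTh2009, Cor 2.19 (ii) p.64] -/
structure CyclotomeTower (l : ℕ) (E : Set ℕ+) : Type where
  /-- `1 ∈ E` (Prop. 2.15) -/
  one_mem : (1 : ℕ+) ∈ E
  /-- `E` is cofinal in `(ℕ≥1, ∣)` -/
  cofinal : ∀ n : ℕ+, ∃ M ∈ E, n ∣ M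
  /-- `E` is totally ordered by divisibility -/
  total : ∀ M ∈ E, ∀ M' ∈ E, M ∣ M' ∨ M' ∣ M
  /-- the identification at level `M` -/
  mod : ∀ M : E, D.CyclotomeMod l M
  /-- compatibility with the reductions: `(l·Δ_Θ ↠ μ_{M'} ↠ μ_M) = (l·Δ_Θ ↠ μ_M)` -/
  red_mod : ∀ (M M' : E) (h : ((M : ℕ+) : ℕ) ∣ (M' : ℕ+)) (x : D.lDeltaTheta l),
    MuN.red p M M' h ((mod M').red x) = (mod M).red x

namespace EtaleThetaData.DoubleUnderline

variable {D} {E : D.EtaleThetaData} {l : ℕ} (C : E.DoubleUnderline l) {Es : Set ℕ+}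
  (τ : D.CyclotomeTower l Es)

/-- Divisibility in `ℕ≥1` is divisibility of the underlying naturals (bookkeeping).
[cite: MochizukiEtTh2009, Cor 2.19 (ii) p.64] -/
theorem pnat_dvd {M M' : Es} (h : (M : ℕ+) ∣ M') : ((M : ℕ+) : ℕ) ∣ (M' : ℕ+) := PNat.dvd_iff.1 h

/-- The reduction of a mod-`M'` theta cocycle is the mod-`M` theta cocycle of the SAME root cocycle.
[cite: MochizukiEtTh2009, Cor 2.19 (ii) p.64] -/
theorem red_comp_modN {M M' : Es} (h : (M : ℕ+) ∣ M')
    (f : contCocycles D.toTheta D.DeltaTheta C.GtpYdduu)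
    (hf : ∀ g, (f.1 g : D.GtpTheta) ∈ D.lDeltaTheta l) :
    MuN.red p M M' (pnat_dvd h) ∘ C.modN (τ.mod M') f hf = C.modN (τ.mod M) f hf := by
  funext g
  exact τ.red_mod M M' (pnat_dvd h) _

/-- "`Ker(Δ^Θ_* ↠ Δ^ell_*) = l·Δ_Θ ⊆ Δ^Θ_*`" for `* = X̲̲` (Prop. 2.12 (i), p. 45; `Π^Θ_X̲̲ := Π^tp_X̲̲ /
Ker(Δ_X ↠ Δ^Θ_X)`, p. 45): inside `Π^tp_X̲̲` the inverse image of `Δ_Θ` IS the inverse image of `l·Δ_Θ`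
(so no subgroup data "`Δ_Θ ⊆ Π^tp_X̲̲` with `[Δ_Θ : l·Δ_Θ] = l`" exists at the level of `Π^tp_X̲̲`; the
number `l` is part of the setting). [cite: MochizukiEtTh2009, Prop 2.12 (i) p.45] -/
theorem comap_DeltaTheta_Huu :
    D.DeltaTheta.comap (D.toTheta.comp C.Huu.subtype) =
      (D.lDeltaTheta l).comap (D.toTheta.comp C.Huu.subtype) := by
  refine le_antisymm ?_ (Subgroup.comap_mono (D.lDeltaTheta_le l))
  intro h hh
  rw [Subgroup.mem_comap] at hh ⊢
  have : (D.toTheta.comp C.Huu.subtype) h ∈ C.Huu.map D.toTheta ⊓ D.DeltaTheta :=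
    ⟨⟨(h : D.PiTemp), h.2, rfl⟩, hh⟩
  rwa [C.map_toTheta_Huu] at this

/-- Hence the relative index of the two inverse images is `1`.
[cite: MochizukiEtTh2009, Prop 2.12 (i) p.45] -/
theorem relIndex_comap_lDeltaTheta_DeltaTheta :
    ((D.lDeltaTheta l).comap (D.toTheta.comp C.Huu.subtype)).relIndex
      (D.DeltaTheta.comap (D.toTheta.comp C.Huu.subtype)) = 1 := by
  rw [C.comap_DeltaTheta_Huu, Subgroup.relIndex_self]

/-- **[EtTh] §2's projective system of theta-environment data for `X̲̲`, INSTANTIATED from §1**: the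
interface `ThetaEnvTower E` of `ThetaSystems.lean` with the levels `thetaEnvData` of part 2, the REAL
reductions `MuN.red` (power maps on the roots of unity of `ℚ̄_p`) and `thetaMod` from the compatible
identifications `τ`; every tower axiom PROVED (reductions onto / functorial / Galois-compatible;
cocycles at the various levels are reductions of one another, all of them; `thetaMod` onto and
compatible). Resolves TODO-merge(abc-iut-L2-t1) of `ThetaEnvTower`. [cite: MochizukiEtTh2009, Cor 2.19 (ii) p.64] -/
abbrev thetaEnvTower (hC : D.Compat) (hS : D.Sec2Hyps) : ThetaEnvTower.{0} Es where
  one_mem := τ.one_mem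
  cofinal := τ.cofinal
  total := τ.total
  PiX := C.Huu
  G := D.GK
  aug := (C.thetaEnvData (τ.mod ⟨1, τ.one_mem⟩) hC hS).aug
  aug_surjective := (C.thetaEnvData (τ.mod ⟨1, τ.one_mem⟩) hC hS).aug_surjective
  PiY := D.GtpY.subgroupOf C.Huu
  PiY_normal := (C.thetaEnvData (τ.mod ⟨1, τ.one_mem⟩) hC hS).PiY_normal
  PiY_open := (C.thetaEnvData (τ.mod ⟨1, τ.one_mem⟩) hC hS).PiY_open
  galYX := (C.thetaEnvData (τ.mod ⟨1, τ.one_mem⟩) hC hS).galYX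
  PiYdd := D.GtpYdd.subgroupOf C.Huu
  PiYdd_le := (C.thetaEnvData (τ.mod ⟨1, τ.one_mem⟩) hC hS).PiYdd_le
  PiYdd_normal := (C.thetaEnvData (τ.mod ⟨1, τ.one_mem⟩) hC hS).PiYdd_normal
  PiYdd_open := (C.thetaEnvData (τ.mod ⟨1, τ.one_mem⟩) hC hS).PiYdd_open
  index_PiYdd := (C.thetaEnvData (τ.mod ⟨1, τ.one_mem⟩) hC hS).index_PiYdd
  mu M := MuN p M
  mu_cyclic M := isCyclic_MuN p M
  card_mu M := card_MuN p M
  chi M := (galMuN p M).comp D.GK.subtype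
  chi_ker_open M := (C.thetaEnvData (τ.mod M) hC hS).chi_ker_open
  thetaCocycles M := C.thetaCocycles hC (τ.mod M)
  thetaCocycles_nonempty M := C.thetaCocycles_nonempty (τ.mod M) hC
  isCocycle M := (C.thetaEnvData (τ.mod M) hC hS).isCocycle
  locallyConstant M := (C.thetaEnvData (τ.mod M) hC hS).locallyConstant
  mul_coboundary_mem M := (C.thetaEnvData (τ.mod M) hC hS).mul_coboundary_mem
  red M M' h := MuN.red p M M' (pnat_dvd h)
  red_surjective M M' h := MuN.red_surjective p M M' (pnat_dvd h)
  red_self M h a := MuN.red_self p M (pnat_dvd h) a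
  red_comp M M' M'' h h' a := MuN.red_comp p M M' M'' (pnat_dvd h) (pnat_dvd h') a
  red_chi M M' h g a := MuN.red_gal p M M' (pnat_dvd h) (g : GQp p) a
  red_cocycle_mem M M' h η hη := by
    obtain ⟨f, hf, rfl⟩ := hη
    exact ⟨f, hf, C.red_comp_modN τ h f hf.1⟩
  red_cocycle_surj M M' h η hη := by
    obtain ⟨f, hf, rfl⟩ := hη
    exact ⟨C.modN (τ.mod M') f hf.1, ⟨f, hf, rfl⟩, C.red_comp_modN τ h f hf.1⟩
  lDeltaTheta := (D.lDeltaTheta l).comap (D.toTheta.comp C.Huu.subtype)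
  thetaMod M := (τ.mod M).red.comp C.toLDelta
  thetaMod_surjective M := by
    intro m
    obtain ⟨a, rfl⟩ := (τ.mod M).red_surjective m
    have ha : (a : D.GtpTheta) ∈ C.Huu.map D.toTheta ⊓ D.DeltaTheta := by
      rw [C.map_toTheta_Huu]; exact a.2
    obtain ⟨⟨h, hh, hha⟩, -⟩ := ha
    refine ⟨⟨⟨h, hh⟩, ?_⟩, ?_⟩
    · rw [Subgroup.mem_comap, MonoidHom.coe_comp, Function.comp_apply, Subgroup.coe_subtype, hha]
      exact a.2
    · rw [MonoidHom.coe_comp, Function.comp_apply]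
      congr 1
      exact Subtype.ext hha
  red_thetaMod M M' h g := τ.red_mod M M' (pnat_dvd h) (C.toLDelta g)

/-- The level-`M` data of the instantiated tower ARE the instantiated level-`M` data of part 2
(definitional bookkeeping). [cite: MochizukiEtTh2009, Cor 2.19 (ii) p.64] -/
theorem thetaEnvTower_thetaCocycles (hC : D.Compat) (hS : D.Sec2Hyps) (M : Es) :
    (C.thetaEnvTower τ hC hS).thetaCocycles M = C.thetaCocycles hC (τ.mod M) := rfl

end EtaleThetaData.DoubleUnderline

/-! ### The 2-torsion of `l·Δ_Θ` dies at every level of a compatible tower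

Seat abc-iut-L2-t10's residual binder `H2 : ∀ t : l·Δ_Θ, t² = 1 → red t = 1` of its Prop. 2.14 (ii) /
Cor. 2.18 (ii) discharge for the model is NOT a consequence of a single `CyclotomeMod` (a `Δ_Θ` with a
2-torsion summand satisfies every typed field at one odd level), but it IS a consequence of a compatible
TOWER: with `M' ∈ E` a multiple of `2M`, `red_M t = (red_{M'} t)^{M'/M}` and `M'/M` is even — the
level-wise shadow of "`Δ_Θ (≅ Ẑ(1))`" (p. 12) being torsion-free. -/

variable {D} in
/-- Over a compatible system of identifications `μ_M ≅ (l·Δ_Θ) ⊗ ℤ/Mℤ` (`CyclotomeTower`), an element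
`t ∈ l·Δ_Θ` with `t² = 1` reduces to `1` in `μ_M` at EVERY level `M ∈ E` ("`Δ_Θ ≅ Ẑ(1)`", p. 12, is
torsion-free; here from cofinality: `red_M = (·)^{M'/M} ∘ red_{M'}` with `2M ∣ M'`).
[cite: MochizukiEtTh2009, Cor 2.19 (ii) p.64] -/
theorem CyclotomeTower.red_eq_one_of_sq_eq_one {l : ℕ} {Es : Set ℕ+} (τ : D.CyclotomeTower l Es)
    (M : Es) (t : D.lDeltaTheta l) (ht : t ^ 2 = 1) : (τ.mod M).red t = 1 := by
  obtain ⟨M', hM'E, hdvd⟩ := τ.cofinal (2 * (M : ℕ+))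
  obtain ⟨c, hc⟩ := PNat.dvd_iff.1 hdvd
  have hM'nat : ((M' : ℕ+) : ℕ) = 2 * (((M : ℕ+) : ℕ) * c) := by
    rw [hc, PNat.mul_coe]; push_cast; ring
  have h2 : (((M : ℕ+) : ℕ)) ∣ ((M' : ℕ+) : ℕ) := ⟨2 * c, by rw [hM'nat]; ring⟩
  have hquot : ((M' : ℕ+) : ℕ) / ((M : ℕ+) : ℕ) = 2 * c := by
    rw [hM'nat, show 2 * (((M : ℕ+) : ℕ) * c) = ((M : ℕ+) : ℕ) * (2 * c) by ring,
      Nat.mul_div_cancel_left _ (M : ℕ+).pos]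
  have key := τ.red_mod M ⟨M', hM'E⟩ h2 t
  rw [← key]
  have hsq : ((τ.mod ⟨M', hM'E⟩).red t) ^ 2 = 1 := by rw [← map_pow, ht, map_one]
  have hsq' : (((τ.mod ⟨M', hM'E⟩).red t : MuN p M') : (PadicAlgCl p)ˣ) ^ 2 = 1 := by
    have := congrArg (fun z : MuN p (M' : ℕ+) => ((z : (PadicAlgCl p)ˣ))) hsq
    simpa using this
  apply Subtype.ext
  rw [MuN.coe_red, hquot, pow_mul, hsq', one_pow]
  rfl

end ThetaSetting

end Literature.AnabelianGeometry.EtaleTheta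

end
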